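import Summits.CriticalPhenomena.PercolationContinuityZ3.Theorems.Transplant.FKConnectivityAllQForestContractionMono
import HarnessLib

/-!
# The PINNING INDUCTION for the square-free adjacent forest Rayleigh node: if in every fibre SOME free pair can be pinned without
# increasing the margin, the node `AdjForestRayleighNoSqOn` holds (proof-only form of the contraction-monotonicity reduction)

Support file (`--supports stmt-CriticalPhenomena-4575`), FK sub-lane `prim-bschramm-fk-1` (gen 24) of the post-continuity programme;
builds on p205010 (kernel theorem, internal audit signed; external expert review pending).  No definitions, no named facts, no sorries;
standard axioms.  Companion of `…ForestContractionMono` (which TYPES the node `AdjForestContractionMonoOn` — contraction monotonicity for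
EVERY free pair — and proves `adjForestRayleighNoSqOn_of_contractionMono`); this file states the reduction with the hypothesis INLINE and in
its weakest useful form (∃ a pinnable pair per fibre), reusing the base-case lemmas of the companion.

`bad(M,u₀) := #(Fo ∩ {e,f ∈ ω}, Fo)`, `good(M,u₀) := #(Fo ∩ {e ∈ ω}, Fo ∩ {f ∈ ω})`, `margin := good − bad` (the coefficient of the adjacent-pair
Rayleigh difference `Δ_{ef}F` at the monomial with exponent 1 on `M`, 2 on `u₀`).
* **`adjForestRayleighNoSqOn_of_exists_pinning`**: suppose that for every fibre `(M, u₀)` with `e, f ∈ M` and at least one further free pair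
  there EXISTS a free pair `g ∈ M ∖ {e,f}` with `margin(M, u₀) ≥ margin(M ∖ {g}, u₀ ∪ {g})` (stated in `ℕ` as
  `bad(M,u₀) + good(M∖g, u₀+g) ≤ good(M,u₀) + bad(M∖g, u₀+g)`).  Then `AdjForestRayleighNoSqOn V`.
  Proof: strong induction on the number of free pairs; the degenerate positions of `e, f` are equalities (`pinning_bad_eq_zero_of_notMem…`,
  `pinning_bad_eq_good_of_pinned…`) and the base fibre `M = {e, f}` has `bad ≤ 1 ≤ good` when `bad ≠ 0` (`adjForestNoSq_base`).
* **`adjForestContractionMonoOn_exists_of_forall`**, **`adjForestRayleighNoSqOn_of_forall_pinning`**: the every-pair form (= `AdjForestContractionMonoOn V`,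
  memo §A) implies the ∃-form, recovering `adjForestRayleighNoSqOn_of_contractionMono`.
Why the ∃-form matters (memo bschramm/FROM-fk-1-g24-HUB-EVENT-CALCULUS.md §A, §5): the induction may CHOOSE the pair to pin, so a proof of the
node needs contraction monotonicity only along ONE selection rule; e.g. pairs at vertices of degree ≤ 2 always qualify (there the rest cannot join
the endpoints in both classes), and in 98.4 % of instances with ≤ 7 vertices some pair even has the one-class-joined sum `s(T_A) ≥ 0`.
EVIDENCE for the hypothesis in its strong (every-pair) form: 0 failures on all connected graphs with ≤ 8 vertices, all `o, e, f, g`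
(1,599,245 tests at n = 8) and on 368,702 random / multigraph tests.  Nothing here asserts it.
[cite: SempleWelsh2008, Conj. 1.1 (p. 2); Thm. 4.2 (p. 11)] [cite: CibulkaHladkyLaCroixWagner2008, Thm. 1 (p. 2)] [cite: Linusson2011, Prop. 2.6]
[cite: Grimmett2006, §1.5 (p. 13)]
-/

noncomputable section

namespace Summit.CriticalPhenomena.PercolationContinuityZ3.Theorems
namespace FK

open MeasureTheory Set Literature.Probability.LatticeModels Literature.Probability.Percolation
open scoped Classical symmDiff

variable {V : Type*} [Fintype V]

/-! ### The pinning induction -/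

/-- **THE PINNING INDUCTION (∃-form).**  If in every fibre with `e, f` free and a further free pair some free pair `g ∉ {e,f}` can be pinned
without increasing the margin, then `bad ≤ good` on every fibre, i.e. `AdjForestRayleighNoSqOn V`.
[cite: SempleWelsh2008, Conj. 1.1 (p. 2)] [cite: CibulkaHladkyLaCroixWagner2008, Thm. 1 (p. 2)] [cite: Linusson2011, Prop. 2.6] -/
theorem adjForestRayleighNoSqOn_of_exists_pinning
    (h : ∀ (M u₀ : BondConfig V), Disjoint u₀ M → ∀ (o v y : V), v ≠ y → s(o, v) ∈ M → s(o, y) ∈ M →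
      (∃ g ∈ M, g ≠ s(o, v) ∧ g ≠ s(o, y)) →
      ∃ g ∈ M, g ≠ s(o, v) ∧ g ≠ s(o, y) ∧
        fibreCount M u₀ (forestEv V ∩ {ω | s(o, v) ∈ ω ∧ s(o, y) ∈ ω}) (forestEv V) +
            fibreCount (M \ {g}) (insert g u₀) (forestEv V ∩ {ω | s(o, v) ∈ ω}) (forestEv V ∩ {ω | s(o, y) ∈ ω}) ≤
          fibreCount M u₀ (forestEv V ∩ {ω | s(o, v) ∈ ω}) (forestEv V ∩ {ω | s(o, y) ∈ ω}) +
            fibreCount (M \ {g}) (insert g u₀) (forestEv V ∩ {ω | s(o, v) ∈ ω ∧ s(o, y) ∈ ω}) (forestEv V)) :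
    AdjForestRayleighNoSqOn V := by
  suffices H : ∀ (k : ℕ) (M u₀ : BondConfig V), M.ncard = k → Disjoint u₀ M → ∀ (o v y : V), v ≠ y →
      fibreCount M u₀ (forestEv V ∩ {ω | s(o, v) ∈ ω ∧ s(o, y) ∈ ω}) (forestEv V) ≤
        fibreCount M u₀ (forestEv V ∩ {ω | s(o, v) ∈ ω}) (forestEv V ∩ {ω | s(o, y) ∈ ω}) from
    fun M u₀ hd o v y hvy => H _ M u₀ rfl hd o v y hvy
  intro k
  induction k using Nat.strong_induction_on with
  | _ k ih =>
    intro M u₀ hk hd o v y hvy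
    by_cases heM : s(o, v) ∈ M
    · by_cases hfM : s(o, y) ∈ M
      · by_cases hM : M = {s(o, v), s(o, y)}
        · exact adjForestNoSq_base hvy hM hd
        · have hss : ({s(o, v), s(o, y)} : BondConfig V) ⊂ M :=
            Set.ssubset_iff_subset_ne.2 ⟨insert_subset heM (singleton_subset_iff.2 hfM), Ne.symm hM⟩
          obtain ⟨g₀, hg₀M, hg₀not⟩ := Set.exists_of_ssubset hss
          obtain ⟨g, hgM, hge, hgf, hstep⟩ := h M u₀ hd o v y hvy heM hfM
            ⟨g₀, hg₀M, fun h' => hg₀not (h' ▸ Or.inl rfl), fun h' => hg₀not (h' ▸ Or.inr rfl)⟩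
          have hlt : (M \ {g}).ncard < k := by
            rw [← hk]; exact Set.ncard_sdiff_singleton_lt_of_mem hgM
          have hd' : Disjoint (insert g u₀) (M \ {g}) :=
            Set.disjoint_insert_left.2 ⟨fun h' => h'.2 rfl, hd.mono_right sdiff_subset⟩
          have hih := ih _ hlt (M \ {g}) (insert g u₀) rfl hd' o v y hvy
          omega
      · by_cases hfu : s(o, y) ∈ u₀
        · exact (adjForestNoSq_bad_eq_good_of_pinned' hd hfu).le
        · rw [adjForestNoSq_bad_eq_zero_of_notMem' hfM hfu]; exact Nat.zero_le _
    · by_cases heu : s(o, v) ∈ u₀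
      · exact (adjForestNoSq_bad_eq_good_of_pinned hd heu).le
      · rw [adjForestNoSq_bad_eq_zero_of_notMem heM heu]; exact Nat.zero_le _

/-- **Every-pair contraction monotonicity ⇒ the ∃-form hypothesis of the pinning induction.** [cite: SempleWelsh2008, Conj. 1.1 (p. 2)] -/
theorem adjForestRayleighNoSqOn_of_forall_pinning (h : AdjForestContractionMonoOn V) : AdjForestRayleighNoSqOn V :=
  adjForestRayleighNoSqOn_of_exists_pinning fun M u₀ hd o v y hvy _ _ ⟨g, hgM, hge, hgf⟩ =>
    ⟨g, hgM, hge, hgf, h M u₀ hd o v y hvy g hgM hge hgf⟩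

end FK
end Summit.CriticalPhenomena.PercolationContinuityZ3.Theorems

end
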